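import Summits.Ventures.HodgeRepro2.T5SU11LegendreHeineBounds
import Mathlib.Algebra.Order.Field.GeomSum

/-!
# The uniform two-sided Laplace–Heine bound: `a_n ≤ e^{−2nt} P_n(cosh 2t) ≤ a_n (1 + 2√n e^{−4t}/(1 − e^{−4t}))`

A quantitative companion of the Laplace–Heine asymptotic, valid for EVERY `n ≥ 1` and `t > 0`: from Heine's expansion
`e^{−2nt} P_n(cosh 2t) = Σ_{j≤n} a_{n−j} a_j e^{−4jt}` the `j = 0` term is `a_n`, and the others are at most
`a_n · 2√n · e^{−4jt}` (`T5SU11LegendreHeineBounds.binomHalf_div_le_sqrt`), so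

  **`a_n ≤ e^{−2nt} P_n(cosh 2t) ≤ a_n (1 + 2√n · e^{−4t}/(1 − e^{−4t}))`**   (`exp_neg_mul_legP_cosh_le_uniform`),

on the group **`c(−2n) ≤ e^{−2nt} φ_{2n+2}(a_t) ≤ c(−2n) (1 + 2√n/(e^{4t} − 1))`** (`exp_neg_mul_sph_even_hyp_le_uniform`):
the leading term `c(−2n) e^{2nt}` of the Harish-Chandra expansion dominates up to the explicit relative error
`2√n/(e^{4t} − 1)`, small as soon as `e^{4t} ≫ √n`. Nothing is claimed about (N).

Blind lane: Mathlib + the HodgeRepro2 prefix only; no sorry; axioms ⊆ {propext, Classical.choice,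
Quot.sound}.
-/

namespace Summit.Ventures.HodgeRepro2.T5SU11LegendreHeineUniform

open Finset
open T5SU11Cartan T5SU11SphericalFunction T5SU11SphericalLegendreAll T5SU11SphericalAsymptotic T5SU11LegendreHeine
  T5SU11LegendreCentralBinomial T5SU11LegendreHeineBounds

/-- **The uniform upper bound** `Σ_{j≤n} a_{n−j} a_j zʲ ≤ a_n (1 + 2√n z/(1 − z))` for `n ≥ 1`, `0 ≤ z < 1`. -/
theorem heine_sum_le_uniform {n : ℕ} (hn : 1 ≤ n) {z : ℝ} (hz0 : 0 ≤ z) (hz1 : z < 1) :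
    ∑ j ∈ range (n + 1), binomHalf (n - j) * binomHalf j * z ^ j
      ≤ binomHalf n * (1 + 2 * Real.sqrt n * z / (1 - z)) := by
  have ha := binomHalf_pos n
  have h1z : 0 < 1 - z := by linarith
  rw [Finset.sum_range_succ', Nat.sub_zero, binomHalf_zero, mul_one, pow_zero, mul_one]
  have hrest : ∑ j ∈ range n, binomHalf (n - (j + 1)) * binomHalf (j + 1) * z ^ (j + 1)
      ≤ binomHalf n * (2 * Real.sqrt n * z / (1 - z)) := by
    have hterm : ∀ j ∈ range n, binomHalf (n - (j + 1)) * binomHalf (j + 1) * z ^ (j + 1)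
        ≤ binomHalf n * (2 * Real.sqrt n) * z ^ (j + 1) := fun j _ => by
      have hr := binomHalf_div_le_sqrt (n := n) (j := j + 1) hn
      rw [div_le_iff₀ ha] at hr
      have hb := binomHalf_le_one (j + 1)
      have hbp := binomHalf_pos (j + 1)
      have hz : 0 ≤ z ^ (j + 1) := pow_nonneg hz0 _
      calc binomHalf (n - (j + 1)) * binomHalf (j + 1) * z ^ (j + 1)
          ≤ binomHalf (n - (j + 1)) * 1 * z ^ (j + 1) := by
            refine mul_le_mul_of_nonneg_right (mul_le_mul_of_nonneg_left hb (binomHalf_pos _).le) hz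
        _ ≤ (2 * Real.sqrt n * binomHalf n) * z ^ (j + 1) := by
            rw [mul_one]
            exact mul_le_mul_of_nonneg_right hr hz
        _ = binomHalf n * (2 * Real.sqrt n) * z ^ (j + 1) := by ring
    calc ∑ j ∈ range n, binomHalf (n - (j + 1)) * binomHalf (j + 1) * z ^ (j + 1)
        ≤ ∑ j ∈ range n, binomHalf n * (2 * Real.sqrt n) * z ^ (j + 1) := Finset.sum_le_sum hterm
      _ = binomHalf n * (2 * Real.sqrt n) * ∑ j ∈ range n, z ^ (j + 1) := by rw [Finset.mul_sum]
      _ = binomHalf n * (2 * Real.sqrt n) * ∑ j ∈ Ico 1 (n + 1), z ^ j := by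
          congr 1
          rw [Finset.sum_Ico_eq_sum_range]
          simp only [Nat.add_sub_cancel]
          refine Finset.sum_congr rfl fun j _ => ?_
          rw [add_comm]
      _ ≤ binomHalf n * (2 * Real.sqrt n) * (z ^ 1 / (1 - z)) :=
          mul_le_mul_of_nonneg_left (geom_sum_Ico_le_of_lt_one hz0 hz1) (by positivity)
      _ = binomHalf n * (2 * Real.sqrt n * z / (1 - z)) := by ring
  linarith

/-- **`a_n ≤ e^{−2nt} P_n(cosh 2t) ≤ a_n (1 + 2√n e^{−4t}/(1 − e^{−4t}))`** for `n ≥ 1`, `t > 0`. -/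
theorem exp_neg_mul_legP_cosh_le_uniform {n : ℕ} (hn : 1 ≤ n) {t : ℝ} (ht : 0 < t) :
    binomHalf n ≤ Real.exp (-(2 * (n : ℝ)) * t) * legP n (Real.cosh (2 * t))
      ∧ Real.exp (-(2 * (n : ℝ)) * t) * legP n (Real.cosh (2 * t))
          ≤ binomHalf n * (1 + 2 * Real.sqrt n * Real.exp (-(4 * t)) / (1 - Real.exp (-(4 * t)))) := by
  refine ⟨(exp_neg_mul_legP_cosh_sub_le n ht.le).1, ?_⟩
  rw [exp_neg_mul_legP_cosh_eq]
  have hz0 : 0 ≤ Real.exp (-(4 * t)) := (Real.exp_pos _).le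
  have hz1 : Real.exp (-(4 * t)) < 1 := by
    have := Real.exp_lt_exp.mpr (show -(4 * t) < 0 by linarith)
    rwa [Real.exp_zero] at this
  have h := heine_sum_le_uniform hn hz0 hz1
  refine le_trans (le_of_eq ?_) h
  refine Finset.sum_congr rfl fun j _ => ?_
  congr 1
  rw [← Real.exp_nat_mul]
  congr 1
  ring

section measure

variable [MeasurableSpace Circle] [BorelSpace Circle]

/-- **On the group**: `c(−2n) ≤ e^{−2nt} φ_{2n+2}(a_t) ≤ c(−2n) (1 + 2√n/(e^{4t} − 1))` for `n ≥ 1`, `t > 0`. -/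
theorem exp_neg_mul_sph_even_hyp_le_uniform {n : ℕ} (hn : 1 ≤ n) {t : ℝ} (ht : 0 < t) :
    cfun (-(2 * (n : ℝ))) ≤ Real.exp (-(2 * (n : ℝ)) * t) * sph (2 * (n : ℝ) + 2) (hyp t)
      ∧ Real.exp (-(2 * (n : ℝ)) * t) * sph (2 * (n : ℝ) + 2) (hyp t)
          ≤ cfun (-(2 * (n : ℝ))) * (1 + 2 * Real.sqrt n / (Real.exp (4 * t) - 1)) := by
  rw [sph_even_hyp, ← binomHalf_eq_cfun]
  obtain ⟨h1, h2⟩ := exp_neg_mul_legP_cosh_le_uniform hn ht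
  refine ⟨h1, h2.trans (le_of_eq ?_)⟩
  congr 2
  have he : 0 < Real.exp (4 * t) := Real.exp_pos _
  have he1 : Real.exp (4 * t) - 1 ≠ 0 := by
    have := Real.exp_lt_exp.mpr (show (0 : ℝ) < 4 * t by linarith)
    rw [Real.exp_zero] at this
    linarith
  have hne : 1 - Real.exp (-(4 * t)) ≠ 0 := by
    have := Real.exp_lt_exp.mpr (show -(4 * t) < 0 by linarith)
    rw [Real.exp_zero] at this
    linarith
  rw [Real.exp_neg]
  field_simp

end measure

end Summit.Ventures.HodgeRepro2.T5SU11LegendreHeineUniform
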